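import Mathlib.Analysis.SpecialFunctions.Pow.Real
import Mathlib.Analysis.SpecialFunctions.Log.Basic
import Literature.Analysis.Complex.DiscZeroDivision
import HarnessLib

/-!
# One extrapolation step of Schneider's method at a cusp

The analytic inequality that drives the induction over integer points in the zero-lower-log-
density theorem (`Literature.NumberTheory.Transcendental.SchneiderCuspGerm`): real sample
points `σ_N ∈ (0, u₀⁻¹]` accumulating at the centre of the disc `|z| ≤ ρ` (`u₀ ≥ 2/ρ`), a
function `F` holomorphic on `|z| < r₁` (`ρ < r₁`) with `|F| ≤ B` on `|z| = ρ` vanishing at the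
sample points indexed by a finite set `Z`; then at any further sample point
`|F(σ_K)| ≤ B (2/(ρ u₀))^{#Z}` (`norm_le_at_sample`, from the crude Schwarz lemma
`Literature.Analysis.Complex.norm_le_of_eq_zero_of_norm_le_half`). The arithmetic kill:
an integer `V` with `|V| ≤ x^T · B · t^n` and `T log x + log B + n log t < 0` vanishes
(`int_eq_zero_of_abs_le`).

## References

* [folklore] Th. Schneider, Math. Ann. 121 (1949) 131–140; M. Waldschmidt, *Acta Math. Acad.
  Sci. Hungar.* 31 (1978) 21–25.
-/

noncomputable section

open Metric Finset

namespace Literature.NumberTheory.Transcendental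

/-- **One extrapolation step.** Let `F` be holomorphic on `|z| < r₁`, `0 < ρ < r₁`, `|F| ≤ B` on
`|z| = ρ` (`B ≥ 0`), `u₀ ≥ 2/ρ`; let `σ : ℕ → ℝ` be injective on `S ⊆ ℕ` with
`0 < σ N ≤ u₀⁻¹` for `N ∈ S`, and suppose `F(σ N) = 0` for `N` in a finite set `Z ⊆ S`. Then
`|F(σ K)| ≤ B · (2/(ρ u₀))^{#Z}` for every `K ∈ S`. [folklore] -/
theorem norm_le_at_sample {F : ℂ → ℂ} {r₁ ρ B u₀ : ℝ} (hρ : 0 < ρ) (hρr : ρ < r₁)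
    (hF : DifferentiableOn ℂ F (ball 0 r₁)) (hB : ∀ z ∈ sphere (0 : ℂ) ρ, ‖F z‖ ≤ B)
    (hB0 : 0 ≤ B) (hu₀ : 2 / ρ ≤ u₀) (σ : ℕ → ℝ) (S : Set ℕ)
    (hσS : ∀ N ∈ S, 0 < σ N ∧ σ N ≤ u₀⁻¹) (hinj : Set.InjOn σ S) (Z : Finset ℕ)
    (hZS : ∀ N ∈ Z, N ∈ S) (hFZ : ∀ N ∈ Z, F (σ N) = 0) {K : ℕ} (hK : K ∈ S) :
    ‖F (σ K)‖ ≤ B * (2 / (ρ * u₀)) ^ Z.card := by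
  classical
  have hu₀pos : 0 < u₀ := lt_of_lt_of_le (by positivity) hu₀
  have hinv : u₀⁻¹ ≤ ρ / 2 := by
    rw [inv_le_comm₀ hu₀pos (by positivity), inv_div]
    exact hu₀
  set s : Finset ℂ := Z.image fun N => ((σ N : ℝ) : ℂ) with hs
  have hsZ : s.card = Z.card := by
    rw [hs, card_image_of_injOn]
    intro N hN N' hN' h
    have h' : ((σ N : ℝ) : ℂ) = σ N' := h
    exact hinj (hZS N hN) (hZS N' hN') (by exact_mod_cast h')
  have hs_half : ∀ c ∈ s, ‖c‖ ≤ ρ / 2 := by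
    intro c hc
    obtain ⟨N, hN, rfl⟩ := mem_image.mp hc
    have h := hσS N (hZS N hN)
    rw [Complex.norm_real, Real.norm_eq_abs, abs_of_pos h.1]
    exact h.2.trans hinv
  have hfs : ∀ c ∈ s, F c = 0 := by
    intro c hc
    obtain ⟨N, hN, rfl⟩ := mem_image.mp hc
    exact hFZ N hN
  have hKσ := hσS K hK
  have hw : ‖((σ K : ℝ) : ℂ)‖ ≤ ρ := by
    rw [Complex.norm_real, Real.norm_eq_abs, abs_of_pos hKσ.1]
    linarith [hKσ.2.trans hinv]
  have hmain := Literature.Analysis.Complex.norm_le_of_eq_zero_of_norm_le_half isOpen_ball hF hρ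
    (closedBall_subset_ball hρr) s hs_half hfs hB hw
  have hprod : ∏ c ∈ s, ‖((σ K : ℝ) : ℂ) - c‖ ≤ (u₀⁻¹) ^ s.card := by
    rw [← prod_const]
    refine prod_le_prod (fun _ _ => norm_nonneg _) fun c hc => ?_
    obtain ⟨N, hN, rfl⟩ := mem_image.mp hc
    have hN' := hσS N (hZS N hN)
    rw [← Complex.ofReal_sub, Complex.norm_real, Real.norm_eq_abs, abs_sub_le_iff]
    constructor <;> linarith [hN'.1, hN'.2, hKσ.1, hKσ.2]
  calc ‖F (σ K)‖ ≤ B * (2 / ρ) ^ s.card * ∏ c ∈ s, ‖((σ K : ℝ) : ℂ) - c‖ := hmain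
    _ ≤ B * (2 / ρ) ^ s.card * (u₀⁻¹) ^ s.card := by gcongr
    _ = B * (2 / (ρ * u₀)) ^ Z.card := by
        rw [hsZ, mul_assoc, ← mul_pow]
        congr 2
        field_simp

/-- **Arithmetic kill.** An integer `V` with `|V| ≤ x^T · B · t^n` (`x, B, t > 0`) and
`T log x + log B + n log t < 0` is zero. [folklore] -/
theorem int_eq_zero_of_abs_le {V : ℤ} {x B t : ℝ} {T n : ℕ} (hx : 0 < x) (hB : 0 < B)
    (ht : 0 < t) (hle : |(V : ℝ)| ≤ x ^ T * B * t ^ n)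
    (hneg : T * Real.log x + Real.log B + n * Real.log t < 0) : V = 0 := by
  have hexp : x ^ T * B * t ^ n = Real.exp (T * Real.log x + Real.log B + n * Real.log t) := by
    rw [Real.exp_add, Real.exp_add, ← Real.log_pow, ← Real.log_pow, Real.exp_log (pow_pos hx _),
      Real.exp_log hB, Real.exp_log (pow_pos ht _)]
  have hlt : |(V : ℝ)| < 1 := by
    calc |(V : ℝ)| ≤ x ^ T * B * t ^ n := hle
      _ < 1 := by rw [hexp]; exact Real.exp_lt_one_iff.mpr hneg
  have : |V| < 1 := by exact_mod_cast hlt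
  exact Int.abs_lt_one_iff.mp this

end Literature.NumberTheory.Transcendental

end
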